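import Summits.QuantumFields.YangMills.Theorems.BalabanUVNodesN15CurvedGluingCubeDefectGluing
import Summits.QuantumFields.YangMills.Theorems.BalabanUVNodesN15TwoSpacingGluingDefect
import HarnessLib

/-!
# N15 = NE2, road (c) — PROGRAMME (PC) «[B9] Sect. C FOR THE LANDAU LETTER WITH PER-CUBE GAUGES (3.35) AS PRINTED», (PC-E) KEYSTONE OF THE AMENDED ARCHITECTURE: THE TWO-GRID
# η-DEFECT OF THE GLUED RANDOM WALK THROUGH A GENERAL TRANSPORT `τ` — dag-n15-w3∕dag-n15-w2∕n15-c's flat two-grid glue (FILE 46 `hasMaj_idef_glueInv`, FILE 57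
# `hasMaj_idef_remainder_in`, `…CubeDefectGluing.hasMaj_idef_glued_of_cutRows_defect`) RE-DERIVED VERBATIM with King's block pull-back `pull π` replaced by an ARBITRARY linear
# transport `τ : (X → ℝ) →ₗ (X′ → ℝ)` and the partition fit `|h′ − h∘π| ≤ o` replaced by the displayed partition-defect row `𝔇_τ(M_{h′_□}, M_{h_□}) ≤ diag o` (dag-n15-c g31, n15-c∕332)

Cell `pub-ymgap`, seat `pub-ymgap-dag-n15-c` (generation g31; R134 (a) seat, strategy s1 «first missing estimate»; HUMAN RULING D-0062; chair R424 venue).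
`bears_on: R4∕N15 · K3⁸ SpineGivenEndpointR13SepCoPHV (stmt-QuantumFields-27366)`; filed `--kind proof --supports stmt-QuantumFields-27366 --as helper` — COUNT-NEUTRAL.
Twelve theorems, 0 `def`, 0 `sorry`; bookkeeping over landed single-grid rows, NO new estimate.  Imports BY NAME `…CurvedGluingCubeDefectGluing` (`hasMaj_defectSum`, `hasMaj_remainderD`;
through it n15-c FILE 57 `…TwoSpacingGluingInputLocalized` (`hasMaj_remainder_in`, `hasMaj_sum_overlap_in`), `…TwoSpacingGluingCutRows` (`parametrix_cut`), FILE 43∕44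
`…TwoSpacingGluing(Cubes)` (`neumannR`, `glueInv`, `parametrix`, `remainder`, `hasMaj_neumannR`, `isUnit_neumannR`, `hasMaj_parametrix`, `hasMaj_sum_overlap`, `hasMaj_comp_diag`,
`hasMaj_diag_comp`)) and FILE 46 `…TwoSpacingGluingDefect`; pub-balaban `T4EtaRateDefect` (`idef`, `idef_comp`, `idef_sub`, `idef_inv`), `T4EtaRateCoeffDefect` (`diagK`,
`hasMaj_mulOp`).  Nothing in the tree is modified, no landed name re-declared; every `_tr` theorem is its flat namesake with `pull π ↦ τ` (proof text identical up to that).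

WHY (director-ym I.20907, architecture of record AMENDED per `PCE-DESIGN-g31.md` §5: «53-knit ∕ `idef_fix` King-style two-grid walk with COVARIANT τ per piece and per-piece cube
gauge pairs»).  The lane's entire two-grid gluing machinery (FILES 46, 57, `…CubeDefectGluing`, dag-n15-w2's `…LocalGaugesTwoGrid(Fit)`, dag-n15-w3's 53) is typed for the FLAT
transport `pull π`, which is refuted for the per-cube class (memo §2).  The covariant transport of the ruling is `τ_{U′} = M_{Sᵀ} ∘ pull π` (dag-n15-a `ctauV`), NOT of the form
`pull π̃`.  Inspection of the flat proofs shows that the ONLY place the shape of the transport enters is pub-balaban's `hasMaj_idef_mulOp` — the defect of the scalar partitions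
`𝔇_{pull}(M_{h′}, M_h) = M_{h′−h∘π}∘pull ≤ diag o` from the fit; everything else is `idef` algebra (`idef_comp`, `idef_inv`, sums) and single-grid rows.  THIS FILE therefore
re-derives the chain for a GENERAL `τ` with that one input DISPLAYED as a row (`hDh`); for `τ = M_Φ ∘ pull π` with `Φ` an entry-bounded colour multiplier commuting with the
(colour-blind) partitions, `hDh` holds with `o ↦ |ι|·o` (the per-piece layer, n15-c∕331 §5 and its sequel, supplies it together with the per-piece twisted defects `hDGc`, `hDK`,
`hDE` — exactly the rows 331 `idef_ctauV_conj_split` produces from the flat defects of the cube-gauge pieces plus dag-n15-a's staircase letter ✓p793284).  With this file the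
covariant two-grid glue is the flat one's text; the gauge layer and the site∕bond instantiation (53's covariant edition) follow the landed pattern of `…LocalGaugesTwoGridFit` →
`…SmoothCutDressedGluedDefectGaugedUN`.

WHAT THIS FILE PROVES (kernel) — `τ : (X → ℝ) →ₗ[ℝ] (X′ → ℝ)` arbitrary; coarse blocks `blk`, fine blocks `blk ∘ π`:
* §1 algebra [folklore]: `idef_id_tr`, `idef_neg_tr`, `idef_fsum_tr`, `idef_sandwich_tr`, `idef_neumannR_tr` (`𝔇_τ(N′,N) = N′∘𝔇_τ(R′,R)∘N`, exact).
* §2 ★★ `hasMaj_idef_parametrix_tr`, ★★ `hasMaj_idef_remainder_in_tr` (partition-defect row `hDh` displayed), ★★ `hasMaj_idef_neumannR_tr`, ★★★ `hasMaj_idef_glueInv_tr`.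
* §3 ★★ `hasMaj_idef_defectSum_tr`, ★★ `hasMaj_idef_remainderD_tr`, ★★★★ `hasMaj_idef_glued_of_cutRows_defect_tr`: the two-grid η-defect `𝔇_τ(𝒢′, 𝒢)` of the glued
  operators with defects `𝒢 = G₀∘(1 − R̃)⁻¹` from the cut rows, commutator rows, defect rows of the pieces on both grids, their `τ`-defects, the partition-defect row and the
  overlap — SAME constant as the flat namesake.

HONEST FRAMING ∕ LIMITS.  A transport-generic transcription of landed theorems; no estimate; the per-piece `τ`-defect rows and the partition-defect row are HYPOTHESES; MODEL
carriers; [Balaban1984PropagatorsII] (2.91) p.239, (2.133)–(2.136) p.247 and [Balaban1985BackgroundPropagators] p.399, Thm 3.14 pp.426–427 = MECHANISM ∕ TEMPLATE, nothing printed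
is asserted.  NE2⁺ NOT PRINTED, NOT proved; N15 of record untouched (DISCHARGED AS CONSUMED, p687738); K3⁸ OPEN; counts of record UNMOVED (typed 28∕28 · discharged 8∕27); one
finite 𝕋⁴ at fixed ε per index — NOT infinite volume, NOT OS on ℝ⁴, NOT a mass gap, NOT Clay; R4 closes the conditional finite-𝕋⁴ rung `BalabanLadder.UV` only.  Restate-immune.
-/

set_option autoImplicit false

noncomputable section
open scoped BigOperators
open Finset

namespace Summit.QuantumFields.YangMills.BalabanUVNodes.N15.Gluing

open Literature.MathematicalPhysics.QuantumFieldTheory.Balaban1983to89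
open Literature.MathematicalPhysics.QuantumFieldTheory.Balaban1983to89.B11SectG (BlockNorm HasMaj RowSum hasMaj_comp hasMaj_comp_exp)
open Literature.MathematicalPhysics.QuantumFieldTheory.Balaban1983to89.T4EtaRateDefect (idef idef_apply idef_comp idef_add idef_sub idef_inv)
open Literature.MathematicalPhysics.QuantumFieldTheory.Balaban1983to89.T4EtaRateCoeffDefect (pull pull_apply diagK diagK_nonneg hasMaj_mulOp)
open Literature.MathematicalPhysics.QuantumFieldTheory.Balaban1983to89.B6RandomWalk (Triangle254)
open Literature.MathematicalPhysics.QuantumFieldTheory.Balaban1983to89.B6Prop26Gluing (mulOp mulOp_apply ind ind_nonneg ind_le_one)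
open Summit.QuantumFields.YangMills.BalabanUVNodes.N15.CurvedSpecies (hasMaj_defectSum hasMaj_remainderD)

/-! ## §1 `idef` algebra through a general transport -/

section Algebra

variable {X X' : Type} [Fintype X] [Fintype X'] [DecidableEq X] [DecidableEq X'] {ι : Type} [Fintype ι] (τ : (X → ℝ) →ₗ[ℝ] (X' → ℝ))

omit [Fintype X] [Fintype X'] [DecidableEq X] [DecidableEq X'] [Fintype ι] in
/-- The identity maps have no η-defect through a common transport. [folklore] -/
theorem idef_id_tr : idef τ τ (LinearMap.id : (X' → ℝ) →ₗ[ℝ] (X' → ℝ)) (LinearMap.id : (X → ℝ) →ₗ[ℝ] (X → ℝ)) = 0 := by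
  refine LinearMap.ext fun μ => ?_
  simp [idef]

omit [Fintype X] [Fintype X'] [DecidableEq X] [DecidableEq X'] [Fintype ι] in
/-- Negation passes through the defect (any transport). [folklore] -/
theorem idef_neg_tr (T' : (X' → ℝ) →ₗ[ℝ] (X' → ℝ)) (T : (X → ℝ) →ₗ[ℝ] (X → ℝ)) : idef τ τ (-T') (-T) = -idef τ τ T' T := by
  refine LinearMap.ext fun f => ?_
  simp only [idef_apply, LinearMap.neg_apply, map_neg, neg_sub_neg, neg_sub]

omit [Fintype X] [Fintype X'] [DecidableEq X] [DecidableEq X'] in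
/-- Finite sums pass through the defect (any transport). [folklore] -/
theorem idef_fsum_tr (T' : ι → (X' → ℝ) →ₗ[ℝ] (X' → ℝ)) (T : ι → (X → ℝ) →ₗ[ℝ] (X → ℝ)) :
    idef τ τ (∑ i, T' i) (∑ i, T i) = ∑ i, idef τ τ (T' i) (T i) := by
  refine LinearMap.ext fun f => ?_
  simp only [idef_apply, LinearMap.coe_sum, Finset.sum_apply, map_sum, Finset.sum_sub_distrib]

omit [Fintype X] [Fintype X'] [DecidableEq X] [DecidableEq X'] [Fintype ι] in
/-- LEIBNIZ for a sandwich `M_{a′}T′M_{b′}` vs `M_aTM_b` through any transport: three terms. [folklore] -/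
theorem idef_sandwich_tr (a' b' : X' → ℝ) (a b : X → ℝ) (T' : (X' → ℝ) →ₗ[ℝ] (X' → ℝ)) (T : (X → ℝ) →ₗ[ℝ] (X → ℝ)) :
    idef τ τ (mulOp a' ∘ₗ T' ∘ₗ mulOp b') (mulOp a ∘ₗ T ∘ₗ mulOp b) =
      mulOp a' ∘ₗ T' ∘ₗ idef τ τ (mulOp b') (mulOp b) + mulOp a' ∘ₗ idef τ τ T' T ∘ₗ mulOp b +
        idef τ τ (mulOp a') (mulOp a) ∘ₗ T ∘ₗ mulOp b := by
  rw [idef_comp τ τ τ, idef_comp τ τ τ, LinearMap.comp_add]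

/-- ★ **EXACT**: `𝔇_τ(N′, N) = N′ ∘ 𝔇_τ(R′, R) ∘ N` for the resummations `N = (1 − R)⁻¹` through any transport (`T4EtaRateDefect.idef_inv`). [folklore] -/
theorem idef_neumannR_tr {R : (X → ℝ) →ₗ[ℝ] (X → ℝ)} {R' : (X' → ℝ) →ₗ[ℝ] (X' → ℝ)} (hunit : IsUnit (1 - LinearMap.toMatrix' R))
    (hunit' : IsUnit (1 - LinearMap.toMatrix' R')) :
    idef τ τ (neumannR R') (neumannR R) = neumannR R' ∘ₗ idef τ τ R' R ∘ₗ neumannR R := by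
  rw [idef_inv τ τ (neumannR_comp_one_sub hunit') (one_sub_comp_neumannR hunit), idef_sub, idef_id_tr τ, zero_sub,
    LinearMap.neg_comp, LinearMap.comp_neg, neg_neg]

end Algebra

/-! ## §2 Parametrix, remainder, resummation, glued inverse through a general transport -/

section Pieces

variable {X X' : Type} [Fintype X] [Fintype X'] {ι : Type} [Fintype ι] {g : B6.Geometry} (blk : X → g.Site) (π : X' → X) (S : ι → Set g.Site)
  (τ : (X → ℝ) →ₗ[ℝ] (X' → ℝ))

/-- ★★ **THE PARAMETRIX's η-DEFECT THROUGH `τ`**: pieces `G_□ ≤ 1_S1_Sβe^{−δd}` on both grids, `𝔇_τ(G′_□, G_□) ≤ 1_S1_S me^{−δd}`, `|h|, |h′| ≤ 1`, the partition-defect ROW `𝔇_τ(M_{h′_□}, M_{h_□}) ≤ diag o`, overlap ⟹ `𝔇_τ(G₀′, G₀) ≤ N_ov(2βo + m)e^{−δd}` (n15-c FILE 44 `hasMaj_idef_parametrix` with `pull π ↦ τ`). [cite: Balaban1984PropagatorsII, (2.133)–(2.134) p.247 (shape); Balaban1985BackgroundPropagators, Thm 3.14 pp.426–427 (difference template)]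 -/
theorem hasMaj_idef_parametrix_tr {h : ι → X → ℝ} {h' : ι → X' → ℝ} {G : ι → (X → ℝ) →ₗ[ℝ] (X → ℝ)} {G' : ι → (X' → ℝ) →ₗ[ℝ] (X' → ℝ)} {β m o δ Nov : ℝ}
    (hβ : 0 ≤ β) (hm : 0 ≤ m) (ho : 0 ≤ o) (hh : ∀ i x, |h i x| ≤ 1) (hh' : ∀ i x', |h' i x'| ≤ 1) (hDh : ∀ i, HasMaj (BlockNorm.ofBlocks g blk) (BlockNorm.ofBlocks g (blk ∘ π)) (idef τ τ (mulOp (h' i)) (mulOp (h i))) (diagK fun _ => o))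
    (hN : ∀ a, ∑ i, ind (S i) a ≤ Nov)
    (hG : ∀ i, HasMaj (BlockNorm.ofBlocks g blk) (BlockNorm.ofBlocks g blk) (G i) (fun y y' => ind (S i) y * ind (S i) y' * (β * Real.exp (-(δ * g.dist y y')))))
    (hG' : ∀ i, HasMaj (BlockNorm.ofBlocks g (blk ∘ π)) (BlockNorm.ofBlocks g (blk ∘ π)) (G' i)
      (fun y y' => ind (S i) y * ind (S i) y' * (β * Real.exp (-(δ * g.dist y y')))))
    (hDG : ∀ i, HasMaj (BlockNorm.ofBlocks g blk) (BlockNorm.ofBlocks g (blk ∘ π)) (idef τ τ (G' i) (G i))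
      (fun y y' => ind (S i) y * ind (S i) y' * (m * Real.exp (-(δ * g.dist y y'))))) :
    HasMaj (BlockNorm.ofBlocks g blk) (BlockNorm.ofBlocks g (blk ∘ π)) (idef τ τ (parametrix h' G') (parametrix h G))
      (fun y y' => Nov * (2 * β * o + m) * Real.exp (-(δ * g.dist y y'))) := by
  have hE : ∀ y y' : g.Site, 0 ≤ Real.exp (-(δ * g.dist y y')) := fun _ _ => Real.exp_nonneg _
  have hterm : ∀ i, HasMaj (BlockNorm.ofBlocks g blk) (BlockNorm.ofBlocks g (blk ∘ π))
      (idef τ τ (mulOp (h' i) ∘ₗ G' i ∘ₗ mulOp (h' i)) (mulOp (h i) ∘ₗ G i ∘ₗ mulOp (h i)))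
      (fun y y' => ind (S i) y * ((2 * β * o + m) * Real.exp (-(δ * g.dist y y')))) := by
    intro i
    have hMa := hasMaj_mulOp (g := g) blk (m := fun _ => (1 : ℝ)) (fun _ => zero_le_one) (hh i)
    have hMa' := hasMaj_mulOp (g := g) (blk ∘ π) (m := fun _ => (1 : ℝ)) (fun _ => zero_le_one) (hh' i)
    have hDM := hDh i
    have hnn : ∀ (c : ℝ), 0 ≤ c → ∀ y y' : g.Site, 0 ≤ ind (S i) y * ind (S i) y' * (c * Real.exp (-(δ * g.dist y y'))) :=
      fun c hc y y' => mul_nonneg (mul_nonneg (ind_nonneg _ _) (ind_nonneg _ _)) (mul_nonneg hc (hE y y'))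
    -- term 1: M_{h′} ∘ G′ ∘ 𝔇(M_{h′}, M_h)
    have t1 := hasMaj_diag_comp (blk ∘ π) (fun _ => zero_le_one) hMa' (hasMaj_comp_diag (blk ∘ π) (hnn β hβ) (hG' i) hDM)
    -- term 2: M_{h′} ∘ 𝔇(G′, G) ∘ M_h
    have t2 := hasMaj_diag_comp (blk ∘ π) (fun _ => zero_le_one) hMa' (hasMaj_comp_diag blk (hnn m hm) (hDG i) hMa)
    -- term 3: 𝔇(M_{h′}, M_h) ∘ G ∘ M_h
    have t3 := hasMaj_diag_comp blk (fun _ => ho) hDM (hasMaj_comp_diag blk (hnn β hβ) (hG i) hMa)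
    rw [idef_sandwich_tr]
    refine ((t1.add t2).add t3).mono fun y y' => ?_
    have h1 := ind_le_one (S i) y'
    have h0 : 0 ≤ ind (S i) y * ((2 * β * o + m) * Real.exp (-(δ * g.dist y y'))) :=
      mul_nonneg (ind_nonneg _ _) (mul_nonneg (by positivity) (hE y y'))
    calc 1 * (ind (S i) y * ind (S i) y' * (β * Real.exp (-(δ * g.dist y y'))) * o) +
          1 * (ind (S i) y * ind (S i) y' * (m * Real.exp (-(δ * g.dist y y'))) * 1) +
          o * (ind (S i) y * ind (S i) y' * (β * Real.exp (-(δ * g.dist y y'))) * 1)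
        = ind (S i) y' * (ind (S i) y * ((2 * β * o + m) * Real.exp (-(δ * g.dist y y')))) := by ring
      _ ≤ 1 * (ind (S i) y * ((2 * β * o + m) * Real.exp (-(δ * g.dist y y')))) := mul_le_mul_of_nonneg_right h1 h0
      _ = _ := one_mul _
  rw [parametrix, parametrix, idef_fsum_tr]
  refine (hasMaj_sum_overlap _ S _ Nov (fun y y' => mul_nonneg (by positivity) (hE y y')) hterm hN).mono fun y y' => le_of_eq ?_
  ring

/-- ★★ **THE REMAINDER's η-DEFECT THROUGH `τ`** from INPUT-localized commutator rows (n15-c FILE 57 `hasMaj_idef_remainder_in` with `pull π ↦ τ`). [cite: Balaban1984PropagatorsII, (2.134)–(2.135) p.247 (shapes); Balaban1985BackgroundPropagators, Thm 3.14 pp.426–427] -/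
theorem hasMaj_idef_remainder_in_tr {Δ : (X → ℝ) →ₗ[ℝ] (X → ℝ)} {Δ' : (X' → ℝ) →ₗ[ℝ] (X' → ℝ)} {h : ι → X → ℝ} {h' : ι → X' → ℝ} {G : ι → (X → ℝ) →ₗ[ℝ] (X → ℝ)}
    {G' : ι → (X' → ℝ) →ₗ[ℝ] (X' → ℝ)} {θ₀ r o δ Nov : ℝ} (hθ : 0 ≤ θ₀) (hr : 0 ≤ r) (ho : 0 ≤ o) (hh : ∀ i x, |h i x| ≤ 1) (hDh : ∀ i, HasMaj (BlockNorm.ofBlocks g blk) (BlockNorm.ofBlocks g (blk ∘ π)) (idef τ τ (mulOp (h' i)) (mulOp (h i))) (diagK fun _ => o))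
    (hN : ∀ b, ∑ i, ind (S i) b ≤ Nov)
    (hK' : ∀ i, HasMaj (BlockNorm.ofBlocks g (blk ∘ π)) (BlockNorm.ofBlocks g (blk ∘ π)) (commOp Δ' (h' i) ∘ₗ G' i)
      (fun y y' => ind (S i) y' * (θ₀ * Real.exp (-(δ * g.dist y y')))))
    (hDK : ∀ i, HasMaj (BlockNorm.ofBlocks g blk) (BlockNorm.ofBlocks g (blk ∘ π)) (idef τ τ (commOp Δ' (h' i) ∘ₗ G' i) (commOp Δ (h i) ∘ₗ G i))
      (fun y y' => ind (S i) y' * (r * Real.exp (-(δ * g.dist y y'))))) :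
    HasMaj (BlockNorm.ofBlocks g blk) (BlockNorm.ofBlocks g (blk ∘ π)) (idef τ τ (remainder Δ' h' G') (remainder Δ h G))
      (fun y y' => Nov * (θ₀ * o + r) * Real.exp (-(δ * g.dist y y'))) := by
  have hE : ∀ y y' : g.Site, 0 ≤ Real.exp (-(δ * g.dist y y')) := fun _ _ => Real.exp_nonneg _
  have hterm : ∀ i, HasMaj (BlockNorm.ofBlocks g blk) (BlockNorm.ofBlocks g (blk ∘ π))
      (idef τ τ ((commOp Δ' (h' i) ∘ₗ G' i) ∘ₗ mulOp (h' i)) ((commOp Δ (h i) ∘ₗ G i) ∘ₗ mulOp (h i)))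
      (fun y y' => ind (S i) y' * ((θ₀ * o + r) * Real.exp (-(δ * g.dist y y')))) := fun i => by
    have hMa := hasMaj_mulOp (g := g) blk (m := fun _ => (1 : ℝ)) (fun _ => zero_le_one) (hh i)
    have hDM := hDh i
    have hnn : ∀ (c : ℝ), 0 ≤ c → ∀ y y' : g.Site, 0 ≤ ind (S i) y' * (c * Real.exp (-(δ * g.dist y y'))) :=
      fun c hc y y' => mul_nonneg (ind_nonneg _ _) (mul_nonneg hc (hE y y'))
    have t1 := hasMaj_comp_diag (blk ∘ π) (hnn θ₀ hθ) (hK' i) hDM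
    have t2 := hasMaj_comp_diag blk (hnn r hr) (hDK i) hMa
    rw [idef_comp τ τ τ]
    refine (t1.add t2).mono fun y y' => le_of_eq ?_
    ring
  rw [remainder, remainder, idef_neg_tr, idef_fsum_tr]
  refine ((hasMaj_sum_overlap_in _ S _ Nov (fun y y' => mul_nonneg (by positivity) (hE y y')) hterm hN).neg).mono fun y y' => le_of_eq ?_
  ring

end Pieces

section Neumann

variable {X X' : Type} [Fintype X] [Fintype X'] [DecidableEq X] [DecidableEq X'] {g : B6.Geometry} (blk : X → g.Site) (π : X' → X) {σ cr : ℝ}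
  (τ : (X → ℝ) →ₗ[ℝ] (X' → ℝ))

/-- ★★ **THE η-DEFECT OF THE RESUMMATION THROUGH `τ`**: `R, R′ ≤ θe^{−δd}` (`θc_r < 1`), `𝔇_τ(R′,R) ≤ re^{−δd}` ⟹ `𝔇_τ(N′,N) ≤ (1−θc_r)⁻²rc_r²e^{−(δ−2σ)d}` (FILE 46 with `pull π ↦ τ`). [cite: Balaban1984PropagatorsII, (2.52)–(2.56) pp.232–233 (mechanism)] -/
theorem hasMaj_idef_neumannR_tr (htri : Triangle254 g) (hd : ∀ a b : g.Site, 0 ≤ g.dist a b) (hd0 : ∀ y : g.Site, g.dist y y = 0) (hrow : RowSum g σ cr) (hσ : 0 ≤ σ)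
    (hcr : 0 ≤ cr) {R : (X → ℝ) →ₗ[ℝ] (X → ℝ)} {R' : (X' → ℝ) →ₗ[ℝ] (X' → ℝ)} {θ r δ : ℝ} (hθ : 0 ≤ θ) (hr : 0 ≤ r) (hσδ : 2 * σ ≤ δ)
    (hR : HasMaj (BlockNorm.ofBlocks g blk) (BlockNorm.ofBlocks g blk) R (fun y y' => θ * Real.exp (-(δ * g.dist y y'))))
    (hR' : HasMaj (BlockNorm.ofBlocks g (blk ∘ π)) (BlockNorm.ofBlocks g (blk ∘ π)) R' (fun y y' => θ * Real.exp (-(δ * g.dist y y'))))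
    (hDR : HasMaj (BlockNorm.ofBlocks g blk) (BlockNorm.ofBlocks g (blk ∘ π)) (idef τ τ R' R) (fun y y' => r * Real.exp (-(δ * g.dist y y'))))
    (hq : θ * cr < 1) :
    HasMaj (BlockNorm.ofBlocks g blk) (BlockNorm.ofBlocks g (blk ∘ π)) (idef τ τ (neumannR R') (neumannR R))
      (fun y y' => (1 - θ * cr)⁻¹ * ((1 - θ * cr)⁻¹ * r * cr) * cr * Real.exp (-((δ - 2 * σ) * g.dist y y'))) := by
  have hσδ' : σ ≤ δ := by linarith
  have hunit := isUnit_neumannR blk hd hrow hθ hσδ' hR hq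
  have hunit' := isUnit_neumannR (blk ∘ π) hd hrow hθ hσδ' hR' hq
  have hinv0 : 0 ≤ (1 - θ * cr)⁻¹ := inv_nonneg.2 (by linarith)
  have hN := hasMaj_neumannR blk htri hd hd0 hrow (ρ := δ - σ) hθ (by linarith) (by linarith) hR hq
  have hN' := hasMaj_neumannR (blk ∘ π) htri hd hd0 hrow (ρ := δ - σ) hθ (by linarith) (by linarith) hR' hq
  -- inner composition `𝔇(R′,R) ∘ N` at rate `δ − σ`
  have h1 := hasMaj_comp_exp (b₁ := BlockNorm.ofBlocks g blk) (b₂ := BlockNorm.ofBlocks g blk) (b₃ := BlockNorm.ofBlocks g (blk ∘ π))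
    (T₁ := idef τ τ R' R) (T₂ := neumannR R) (ρ := δ - σ) htri hd hrow hr hinv0 (by linarith) le_rfl (by linarith) hDR hN
  have h1' : HasMaj (BlockNorm.ofBlocks g blk) (BlockNorm.ofBlocks g (blk ∘ π)) (idef τ τ R' R ∘ₗ neumannR R)
      (fun y y' => (1 - θ * cr)⁻¹ * r * cr * Real.exp (-((δ - σ) * g.dist y y'))) := by
    refine h1.mono fun a b => le_of_eq ?_
    rw [show (BlockNorm.ofBlocks g blk).κ = 1 from rfl]
    ring
  -- outer composition `N′ ∘ (𝔇(R′,R) ∘ N)` at rate `δ − 2σ`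
  have h2 := hasMaj_comp_exp (b₁ := BlockNorm.ofBlocks g blk) (b₂ := BlockNorm.ofBlocks g (blk ∘ π)) (b₃ := BlockNorm.ofBlocks g (blk ∘ π))
    (T₁ := neumannR R') (T₂ := idef τ τ R' R ∘ₗ neumannR R) (ρ := δ - 2 * σ) htri hd hrow hinv0
    (mul_nonneg (mul_nonneg hinv0 hr) hcr) (by linarith) (by linarith) (by linarith) hN' h1'
  rw [idef_neumannR_tr τ hunit hunit']
  refine h2.mono fun a b => le_of_eq ?_
  rw [show (BlockNorm.ofBlocks g (blk ∘ π)).κ = 1 from rfl]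
  ring

/-- ★★★ **THE η-DEFECT OF THE GLUED INVERSE THROUGH `τ`**: `𝔇_τ(G′, G) = G₀′∘𝔇_τ(N′,N) + 𝔇_τ(G₀′,G₀)∘N ≤ [A(1−θc_r)⁻²rc_r³ + m(1−θc_r)⁻¹c_r]e^{−(δ−2σ)d}` (FILE 46 `hasMaj_idef_glueInv` with `pull π ↦ τ`). [cite: Balaban1984PropagatorsII, (2.91) p.239, (2.135)–(2.136) p.247 (mechanism); Balaban1985BackgroundPropagators, p.399, Thm 3.14 pp.426–427] -/
theorem hasMaj_idef_glueInv_tr (htri : Triangle254 g) (hd : ∀ a b : g.Site, 0 ≤ g.dist a b) (hd0 : ∀ y : g.Site, g.dist y y = 0) (hrow : RowSum g σ cr) (hσ : 0 ≤ σ)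
    (hcr : 0 ≤ cr) {G₀ R : (X → ℝ) →ₗ[ℝ] (X → ℝ)} {G₀' R' : (X' → ℝ) →ₗ[ℝ] (X' → ℝ)} {A θ m r δ : ℝ} (hA : 0 ≤ A) (hθ : 0 ≤ θ) (hm : 0 ≤ m) (hr : 0 ≤ r)
    (hσδ : 2 * σ ≤ δ)
    (hG₀' : HasMaj (BlockNorm.ofBlocks g (blk ∘ π)) (BlockNorm.ofBlocks g (blk ∘ π)) G₀' (fun y y' => A * Real.exp (-(δ * g.dist y y'))))
    (hR : HasMaj (BlockNorm.ofBlocks g blk) (BlockNorm.ofBlocks g blk) R (fun y y' => θ * Real.exp (-(δ * g.dist y y'))))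
    (hR' : HasMaj (BlockNorm.ofBlocks g (blk ∘ π)) (BlockNorm.ofBlocks g (blk ∘ π)) R' (fun y y' => θ * Real.exp (-(δ * g.dist y y'))))
    (hDG₀ : HasMaj (BlockNorm.ofBlocks g blk) (BlockNorm.ofBlocks g (blk ∘ π)) (idef τ τ G₀' G₀) (fun y y' => m * Real.exp (-(δ * g.dist y y'))))
    (hDR : HasMaj (BlockNorm.ofBlocks g blk) (BlockNorm.ofBlocks g (blk ∘ π)) (idef τ τ R' R) (fun y y' => r * Real.exp (-(δ * g.dist y y'))))
    (hq : θ * cr < 1) :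
    HasMaj (BlockNorm.ofBlocks g blk) (BlockNorm.ofBlocks g (blk ∘ π)) (idef τ τ (glueInv G₀' R') (glueInv G₀ R))
      (fun y y' => (A * ((1 - θ * cr)⁻¹ * ((1 - θ * cr)⁻¹ * r * cr) * cr) * cr + m * (1 - θ * cr)⁻¹ * cr) * Real.exp (-((δ - 2 * σ) * g.dist y y'))) := by
  have hinv0 : 0 ≤ (1 - θ * cr)⁻¹ := inv_nonneg.2 (by linarith)
  have hN := hasMaj_neumannR blk htri hd hd0 hrow (ρ := δ - σ) hθ (by linarith) (by linarith) hR hq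
  have hDN := hasMaj_idef_neumannR_tr blk π τ htri hd hd0 hrow hσ hcr hθ hr hσδ hR hR' hDR hq
  -- term 1: `G₀′ ∘ 𝔇(N′,N)` at rate `δ − 2σ` (margin from `G₀′`)
  have h1 := hasMaj_comp_exp (b₁ := BlockNorm.ofBlocks g blk) (b₂ := BlockNorm.ofBlocks g (blk ∘ π)) (b₃ := BlockNorm.ofBlocks g (blk ∘ π))
    (T₁ := G₀') (T₂ := idef τ τ (neumannR R') (neumannR R)) (ρ := δ - 2 * σ) htri hd hrow hA
    (mul_nonneg (mul_nonneg hinv0 (mul_nonneg (mul_nonneg hinv0 hr) hcr)) hcr) (by linarith) le_rfl (by linarith) hG₀' hDN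
  -- term 2: `𝔇(G₀′,G₀) ∘ N` at rate `δ − σ`, weakened to `δ − 2σ`
  have h2 := hasMaj_comp_exp (b₁ := BlockNorm.ofBlocks g blk) (b₂ := BlockNorm.ofBlocks g blk) (b₃ := BlockNorm.ofBlocks g (blk ∘ π))
    (T₁ := idef τ τ G₀' G₀) (T₂ := neumannR R) (ρ := δ - 2 * σ) htri hd hrow hm hinv0 (by linarith) (by linarith) (by linarith) hDG₀ hN
  rw [glueInv, glueInv, idef_comp τ τ τ]
  refine (h1.add h2).mono fun a b => le_of_eq ?_
  rw [show (BlockNorm.ofBlocks g blk).κ = 1 from rfl, show (BlockNorm.ofBlocks g (blk ∘ π)).κ = 1 from rfl]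
  ring

end Neumann

/-! ## §3 The glued operator with defects through a general transport -/

section Glued

variable {X X' : Type} [Fintype X] [Fintype X'] [DecidableEq X] [DecidableEq X'] {ι : Type} [Fintype ι] {g : B6.Geometry} (blk : X → g.Site) (π : X' → X)
  (S : ι → Set g.Site) {σ cr : ℝ} (τ : (X → ℝ) →ₗ[ℝ] (X' → ℝ))

omit [DecidableEq X] [DecidableEq X'] in
/-- ★★ **THE DEFECT SUM's η-DEFECT THROUGH `τ`** (`…CubeDefectGluing.hasMaj_idef_defectSum` with `pull π ↦ τ`). [cite: Balaban1985BackgroundPropagators, Thm 3.14 pp.426–427 (difference template); Balaban1984PropagatorsII, (2.135) p.247] -/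
theorem hasMaj_idef_defectSum_tr {h : ι → X → ℝ} {h' : ι → X' → ℝ} {E : ι → (X → ℝ) →ₗ[ℝ] (X → ℝ)} {E' : ι → (X' → ℝ) →ₗ[ℝ] (X' → ℝ)} {ε rE o δ Nov : ℝ} (hε : 0 ≤ ε) (hrE : 0 ≤ rE)
    (ho : 0 ≤ o) (hh : ∀ i x, |h i x| ≤ 1) (hDh : ∀ i, HasMaj (BlockNorm.ofBlocks g blk) (BlockNorm.ofBlocks g (blk ∘ π)) (idef τ τ (mulOp (h' i)) (mulOp (h i))) (diagK fun _ => o)) (hN : ∀ a, ∑ i, ind (S i) a ≤ Nov)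
    (hE' : ∀ i, HasMaj (BlockNorm.ofBlocks g (blk ∘ π)) (BlockNorm.ofBlocks g (blk ∘ π)) (E' i) (fun y y' => ind (S i) y * (ε * Real.exp (-(δ * g.dist y y')))))
    (hDE : ∀ i, HasMaj (BlockNorm.ofBlocks g blk) (BlockNorm.ofBlocks g (blk ∘ π)) (idef τ τ (E' i) (E i)) (fun y y' => ind (S i) y * (rE * Real.exp (-(δ * g.dist y y'))))) :
    HasMaj (BlockNorm.ofBlocks g blk) (BlockNorm.ofBlocks g (blk ∘ π)) (idef τ τ (∑ i, E' i ∘ₗ mulOp (h' i)) (∑ i, E i ∘ₗ mulOp (h i)))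
      (fun y y' => Nov * ((ε * o + rE) * Real.exp (-(δ * g.dist y y')))) := by
  have hsum : idef τ τ (∑ i, E' i ∘ₗ mulOp (h' i)) (∑ i, E i ∘ₗ mulOp (h i)) = ∑ i, idef τ τ (E' i ∘ₗ mulOp (h' i)) (E i ∘ₗ mulOp (h i)) := by
    refine LinearMap.ext fun v => funext fun x' => ?_
    simp only [idef_apply, LinearMap.coe_sum, Finset.sum_apply, LinearMap.comp_apply, Pi.sub_apply, map_sum, Finset.sum_sub_distrib]
  have hterm : ∀ i, HasMaj (BlockNorm.ofBlocks g blk) (BlockNorm.ofBlocks g (blk ∘ π)) (idef τ τ (E' i ∘ₗ mulOp (h' i)) (E i ∘ₗ mulOp (h i)))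
      (fun y y' => ind (S i) y * ((ε * o + rE) * Real.exp (-(δ * g.dist y y')))) := fun i => by
    rw [idef_comp τ τ τ (E' i) (mulOp (h' i)) (E i) (mulOp (h i))]
    have t1 := hasMaj_comp_diag (blk ∘ π) (m := fun _ => o) (fun y y' => mul_nonneg (ind_nonneg _ _) (mul_nonneg hε (Real.exp_nonneg _))) (hE' i)
      (hDh i)
    have t2 := hasMaj_comp_diag blk (m := fun _ => (1 : ℝ)) (fun y y' => mul_nonneg (ind_nonneg _ _) (mul_nonneg hrE (Real.exp_nonneg _))) (hDE i)
      (hasMaj_mulOp blk (fun _ => zero_le_one) (hh i))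
    refine (t1.add t2).mono fun y y' => le_of_eq ?_
    ring
  rw [hsum]
  exact hasMaj_sum_overlap (b₁ := BlockNorm.ofBlocks g blk) (b₃ := BlockNorm.ofBlocks g (blk ∘ π)) _ S _ Nov (fun y y' => by positivity) hterm hN

omit [DecidableEq X] [DecidableEq X'] in
/-- ★★ **THE FULL REMAINDER's η-DEFECT THROUGH `τ`** (`…CubeDefectGluing.hasMaj_idef_remainderD` with `pull π ↦ τ`). [cite: Balaban1985BackgroundPropagators, Thm 3.14 pp.426–427 (template)] -/
theorem hasMaj_idef_remainderD_tr {Δ : (X → ℝ) →ₗ[ℝ] (X → ℝ)} {Δ' : (X' → ℝ) →ₗ[ℝ] (X' → ℝ)} {h : ι → X → ℝ} {h' : ι → X' → ℝ} {G E : ι → (X → ℝ) →ₗ[ℝ] (X → ℝ)}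
    {G' E' : ι → (X' → ℝ) →ₗ[ℝ] (X' → ℝ)} {θ₀ r ε rE o δ Nov : ℝ} (hθ : 0 ≤ θ₀) (hr : 0 ≤ r) (hε : 0 ≤ ε) (hrE : 0 ≤ rE) (ho : 0 ≤ o) (hh : ∀ i x, |h i x| ≤ 1)
    (hDh : ∀ i, HasMaj (BlockNorm.ofBlocks g blk) (BlockNorm.ofBlocks g (blk ∘ π)) (idef τ τ (mulOp (h' i)) (mulOp (h i))) (diagK fun _ => o)) (hN : ∀ a, ∑ i, ind (S i) a ≤ Nov)
    (hK' : ∀ i, HasMaj (BlockNorm.ofBlocks g (blk ∘ π)) (BlockNorm.ofBlocks g (blk ∘ π)) (commOp Δ' (h' i) ∘ₗ G' i) (fun y y' => ind (S i) y' * (θ₀ * Real.exp (-(δ * g.dist y y')))))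
    (hDK : ∀ i, HasMaj (BlockNorm.ofBlocks g blk) (BlockNorm.ofBlocks g (blk ∘ π)) (idef τ τ (commOp Δ' (h' i) ∘ₗ G' i) (commOp Δ (h i) ∘ₗ G i))
      (fun y y' => ind (S i) y' * (r * Real.exp (-(δ * g.dist y y')))))
    (hE' : ∀ i, HasMaj (BlockNorm.ofBlocks g (blk ∘ π)) (BlockNorm.ofBlocks g (blk ∘ π)) (E' i) (fun y y' => ind (S i) y * (ε * Real.exp (-(δ * g.dist y y')))))
    (hDE : ∀ i, HasMaj (BlockNorm.ofBlocks g blk) (BlockNorm.ofBlocks g (blk ∘ π)) (idef τ τ (E' i) (E i)) (fun y y' => ind (S i) y * (rE * Real.exp (-(δ * g.dist y y'))))) :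
    HasMaj (BlockNorm.ofBlocks g blk) (BlockNorm.ofBlocks g (blk ∘ π))
      (idef τ τ (remainder Δ' h' G' - ∑ i, E' i ∘ₗ mulOp (h' i)) (remainder Δ h G - ∑ i, E i ∘ₗ mulOp (h i)))
      (fun y y' => Nov * (θ₀ * o + r + (ε * o + rE)) * Real.exp (-(δ * g.dist y y'))) := by
  rw [idef_sub]
  refine ((hasMaj_idef_remainder_in_tr blk π S τ hθ hr ho hh hDh hN hK' hDK).sub (hasMaj_idef_defectSum_tr blk π S τ hε hrE ho hh hDh hN hE' hDE)).mono fun y y' => le_of_eq ?_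
  ring

/-- ★★★★ **THE TWO-GRID η-DEFECT OF THE GLUED OPERATOR WITH DEFECTS THROUGH A GENERAL TRANSPORT `τ`** — `…CubeDefectGluing.hasMaj_idef_glued_of_cutRows_defect` with `pull π ↦ τ` and the partition fit replaced by the partition-defect row: the keystone of the amended (PC-E) architecture (covariant `τ_{U′} = M_{Sᵀ}∘pull`, per-piece rows from n15-c∕331 §5). [cite: Balaban1984PropagatorsII, (2.91) p.239, (2.133)–(2.136) p.247 (mechanism); Balaban1985BackgroundPropagators, (3.87)–(3.90) pp.409–410, p.399, Thm 3.14 pp.426–427 (difference template); King1986, Prop. 3.9 (3.73) p.665 (η-rate shape)] -/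
theorem hasMaj_idef_glued_of_cutRows_defect_tr (htri : Triangle254 g) (hd : ∀ a b : g.Site, 0 ≤ g.dist a b) (hd0 : ∀ y : g.Site, g.dist y y = 0) (hrow : RowSum g σ cr) (hσ : 0 ≤ σ)
    (hcr : 0 ≤ cr) {Δ : (X → ℝ) →ₗ[ℝ] (X → ℝ)} {Δ' : (X' → ℝ) →ₗ[ℝ] (X' → ℝ)} {h χ : ι → X → ℝ} {h' χ' : ι → X' → ℝ} {G E : ι → (X → ℝ) →ₗ[ℝ] (X → ℝ)}
    {G' E' : ι → (X' → ℝ) →ₗ[ℝ] (X' → ℝ)} {β θ₀ ε m r rE o δ Nov : ℝ} (hβ : 0 ≤ β) (hθ : 0 ≤ θ₀) (hε : 0 ≤ ε) (hm : 0 ≤ m) (hr : 0 ≤ r) (hrE : 0 ≤ rE) (ho : 0 ≤ o)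
    (hNov : 0 ≤ Nov) (hσδ : 2 * σ ≤ δ) (hcut : ∀ i, mulOp (h i) ∘ₗ mulOp (χ i) = mulOp (h i)) (hcut' : ∀ i, mulOp (h' i) ∘ₗ mulOp (χ' i) = mulOp (h' i))
    (hh : ∀ i x, |h i x| ≤ 1) (hh' : ∀ i x', |h' i x'| ≤ 1) (hDh : ∀ i, HasMaj (BlockNorm.ofBlocks g blk) (BlockNorm.ofBlocks g (blk ∘ π)) (idef τ τ (mulOp (h' i)) (mulOp (h i))) (diagK fun _ => o)) (hN : ∀ b, ∑ i, ind (S i) b ≤ Nov)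
    (hGc : ∀ i, HasMaj (BlockNorm.ofBlocks g blk) (BlockNorm.ofBlocks g blk) (mulOp (χ i) ∘ₗ G i) (fun y y' => ind (S i) y * ind (S i) y' * (β * Real.exp (-(δ * g.dist y y')))))
    (hGc' : ∀ i, HasMaj (BlockNorm.ofBlocks g (blk ∘ π)) (BlockNorm.ofBlocks g (blk ∘ π)) (mulOp (χ' i) ∘ₗ G' i)
      (fun y y' => ind (S i) y * ind (S i) y' * (β * Real.exp (-(δ * g.dist y y')))))
    (hK : ∀ i, HasMaj (BlockNorm.ofBlocks g blk) (BlockNorm.ofBlocks g blk) (commOp Δ (h i) ∘ₗ G i) (fun y y' => ind (S i) y' * (θ₀ * Real.exp (-(δ * g.dist y y')))))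
    (hK' : ∀ i, HasMaj (BlockNorm.ofBlocks g (blk ∘ π)) (BlockNorm.ofBlocks g (blk ∘ π)) (commOp Δ' (h' i) ∘ₗ G' i)
      (fun y y' => ind (S i) y' * (θ₀ * Real.exp (-(δ * g.dist y y')))))
    (hE : ∀ i, HasMaj (BlockNorm.ofBlocks g blk) (BlockNorm.ofBlocks g blk) (E i) (fun y y' => ind (S i) y * (ε * Real.exp (-(δ * g.dist y y')))))
    (hE' : ∀ i, HasMaj (BlockNorm.ofBlocks g (blk ∘ π)) (BlockNorm.ofBlocks g (blk ∘ π)) (E' i) (fun y y' => ind (S i) y * (ε * Real.exp (-(δ * g.dist y y')))))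
    (hDGc : ∀ i, HasMaj (BlockNorm.ofBlocks g blk) (BlockNorm.ofBlocks g (blk ∘ π)) (idef τ τ (mulOp (χ' i) ∘ₗ G' i) (mulOp (χ i) ∘ₗ G i))
      (fun y y' => ind (S i) y * ind (S i) y' * (m * Real.exp (-(δ * g.dist y y')))))
    (hDK : ∀ i, HasMaj (BlockNorm.ofBlocks g blk) (BlockNorm.ofBlocks g (blk ∘ π)) (idef τ τ (commOp Δ' (h' i) ∘ₗ G' i) (commOp Δ (h i) ∘ₗ G i))
      (fun y y' => ind (S i) y' * (r * Real.exp (-(δ * g.dist y y')))))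
    (hDE : ∀ i, HasMaj (BlockNorm.ofBlocks g blk) (BlockNorm.ofBlocks g (blk ∘ π)) (idef τ τ (E' i) (E i)) (fun y y' => ind (S i) y * (rE * Real.exp (-(δ * g.dist y y')))))
    (hq : Nov * (θ₀ + ε) * cr < 1) :
    HasMaj (BlockNorm.ofBlocks g blk) (BlockNorm.ofBlocks g (blk ∘ π))
      (idef τ τ (glueInv (parametrix h' G') (remainder Δ' h' G' - ∑ i, E' i ∘ₗ mulOp (h' i)))
        (glueInv (parametrix h G) (remainder Δ h G - ∑ i, E i ∘ₗ mulOp (h i))))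
      (fun y y' => (Nov * β * ((1 - Nov * (θ₀ + ε) * cr)⁻¹ * ((1 - Nov * (θ₀ + ε) * cr)⁻¹ * (Nov * (θ₀ * o + r + (ε * o + rE))) * cr) * cr) * cr +
        Nov * (2 * β * o + m) * (1 - Nov * (θ₀ + ε) * cr)⁻¹ * cr) * Real.exp (-((δ - 2 * σ) * g.dist y y'))) := by
  have e0 := parametrix_cut (G := G) hcut
  have e0' := parametrix_cut (G := G') hcut'
  have hP' := hasMaj_parametrix (blk ∘ π) S hβ hh' hN hGc'
  have hIP := hasMaj_idef_parametrix_tr blk π S τ hβ hm ho hh hh' hDh hN hGc hGc' hDGc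
  rw [e0'] at hP'
  rw [e0, e0'] at hIP
  exact hasMaj_idef_glueInv_tr blk π τ htri hd hd0 hrow hσ hcr (mul_nonneg hNov hβ) (mul_nonneg hNov (add_nonneg hθ hε)) (mul_nonneg hNov (by positivity)) (mul_nonneg hNov (by positivity))
    hσδ hP' (hasMaj_remainderD blk S hθ hε hh hN hK hE) (hasMaj_remainderD (blk ∘ π) S hθ hε hh' hN hK' hE') hIP
    (hasMaj_idef_remainderD_tr blk π S τ hθ hr hε hrE ho hh hDh hN hK' hDK hE' hDE) hq

end Glued

end Summit.QuantumFields.YangMills.BalabanUVNodes.N15.Gluing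

end
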